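import Literature.Barriers.AtomisticToContinuum.DisorderedHarmonicChainLowFrequency
import Literature.Barriers.AtomisticToContinuum.DisorderedHarmonicChainLowerBound
import Literature.Barriers.AtomisticToContinuum.DisorderedHarmonicChainRestart
import Literature.Barriers.AtomisticToContinuum.DisorderedHarmonicChainInvGammaProofs
import Literature.Analysis.FunctionSpaces.TorusDirichletKernelProofs
import Mathlib.Analysis.SpecialFunctions.Integrals.Basic
import Mathlib.MeasureTheory.Integral.IntervalIntegral.Periodic
import HarnessLib

/-!
# Ajanki–Huveneers 2011, §6.2 (6.11)–(6.15): the pointwise frequency bound reduced to Prop. 5.1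

Sibling of `DisorderedHarmonicChainLowFrequency.lean` (provefact unit for the named fact
`AjankiHuveneers2011_pointwiseCurrentBound`:
`𝔼[(1 + w⁻²D_n(e₁;w)²)⁻¹] ≤ C max{w/√n, w²} e^{-αw²n}` for `c/n ≤ w ≤ w₀`). Source: O. Ajanki,
F. Huveneers, CMP **301** (2011) 841–883, arXiv:1003.1076, §6.2, the `𝒥₂` part of the proof of
the upper bound (equation numbers of arXiv v1: (6.11), (6.13)–(6.15) and the display before
(6.16)).

PROVED here: `AjankiHuveneers2011_pointwiseCurrentBound_of_potentialTheory :
AjankiHuveneers2011_potentialTheory → AjankiHuveneers2011_pointwiseCurrentBound`, i.e. the whole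
printed derivation, from the inputs the tree has as theorems — Cor. 3.6 in the everywhere-valid
polar form of `…LowerBound.lean` (`D_n sin πϑ = ρ_n sin πX^ϑ_n`, `ρ_n = ρ_1Γ^ϑ_n`), the restart /
conditioning structure of `…Restart.lean`, the expansion (3.21) of `log Γ`
(`AjankiHuveneers2011_logGammaExpansion_holds`) and Prop. 4.1
(`AjankiHuveneers2011_invGammaDecay_holds`) — and the one input that is still a named fact,
Prop. 5.1 (`AjankiHuveneers2011_potentialTheory` of `…Phases.lean`, its own provefact unit,
`…Potential.lean`). Steps, as printed:

* (6.11) `1/(1 + w⁻²D_n²(e₁)) ≲ h(Γ^ϑ_n sin πX^ϑ_n)`, `h(r) = 1/(1 + w⁻⁴r²)`: here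
  `w²/(w² + D_n²) ≤ 1/(1 + a²Γ²S²/((6π)²w⁴))` from `Γ|S| ≤ 3πw|D_n|` (`ahD_e₁_lower`,
  `majorant_le_lorentz`).
* (6.13) conditioning on the first `r = n - m` steps, `m = min{n, ⌊w⁻²⌋}`:
  `Γ^ϑ_n = Γ^ϑ_r · φ · Γ^{X_r}_m(θ_rB)` (`majorant_append_le`, Fubini `integral_pi_append`).
* (6.14) `h(aΓ^x_m sin πX^x_m) ≤ 1_A + 1_{A^c} w⁴(aΓ sin πX_m)⁻²`, `A = {w⁻⁴a² sin²πX_m ≤ 1}`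
  (`lorentz_le_cut`, `cut_sum_le`), with `Γ_m⁻² ≲ e^{w∑h₂(X_{k-1})B_k}`, `h₂ = -2s`, for
  `w²m ≤ 1` by (3.21) (`ahGamma_inv_sq_le`).
* (6.15) Prop. 5.1 twice and `∫_𝕋 dy/(1 + w⁻⁴a² sin²πy) ≲ w²/a` (`integral_inv_one_add_sq_sin_le`:
  periodicity, Jordan's inequality, `arctan`), giving `𝔼(… | x, a) ≲ (w/√m) a⁻¹`
  (`pointwise_core`); then Prop. 4.1: `(w/√m)𝔼(1/Γ^ϑ_{n-m}) ≲ (w/√m)e^{-αw²(n-m)} ≲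
  max{w/√n, w²}e^{-αw²n}` (`AjankiHuveneers2011_pointwiseCurrentBound_of_potentialTheory`).

No new named facts (D-0026): everything below is a theorem; the discharge
`AjankiHuveneers2011_pointwiseCurrentBound_holds` follows from this file the moment
`AjankiHuveneers2011_potentialTheory` is discharged.
-/

noncomputable section

open MeasureTheory Real

namespace Literature.Barriers.AtomisticToContinuum.HeatConduction

/-! ### The frequency integral of (6.15): `∫_𝕋 dy/(1 + λ² sin²πy) ≤ π/(2λ)`

Jordan's inequality `2|y| ≤ |sin πy|` on `|y| ≤ 1/2` is
`Literature.Analysis.FunctionSpaces.Torus.two_mul_abs_le_abs_sin_pi_mul` (reused, not restated). -/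

/-- `∫_{-1/2}^{1/2} dy/(1 + (2λy)²) = arctan(λ)/λ ≤ π/(2λ)` ("the change of variables `z = w⁻²ay`",
`∫_ℝ dz/(1+z²) = π`). [cite: AjankiHuveneers2011, §6.2 eq. (6.15)] -/
theorem integral_lorentz_le {lam : ℝ} (hlam : 0 < lam) :
    ∫ y in (-(1 / 2 : ℝ))..(1 / 2), 1 / (1 + (2 * lam * y) ^ 2) ≤ π / (2 * lam) := by
  have h := intervalIntegral.integral_comp_mul_left (fun z : ℝ => 1 / (1 + z ^ 2))
    (a := -(1 / 2 : ℝ)) (b := 1 / 2) (c := 2 * lam) (by positivity)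
  rw [h, smul_eq_mul, show 2 * lam * -(1 / 2 : ℝ) = -lam by ring,
    show 2 * lam * (1 / 2 : ℝ) = lam by ring, integral_one_div_one_add_sq, Real.arctan_neg,
    sub_neg_eq_add, inv_mul_le_iff₀ (by positivity : (0 : ℝ) < 2 * lam)]
  have h1 : Real.arctan lam < π / 2 := Real.arctan_lt_pi_div_two lam
  calc Real.arctan lam + Real.arctan lam ≤ π := by linarith
    _ = 2 * lam * (π / (2 * lam)) := by field_simp

/-- **The `y`-integral of (6.15)**: `∫_𝕋 dy/(1 + λ² sin²πy) ≤ π/(2λ)` for `λ > 0`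
("`∫_𝕋 dy/(1 + w⁻⁴a² sin²πy) ≲ ∫_{-1/2}^{1/2} dy/(1 + (w⁻²a y)²) ≤ w²a⁻¹∫ dz/(1+z²)`": the
integrand is `1`-periodic, so `∫_0^1 = ∫_{-1/2}^{1/2}`, and `sin² πy ≥ 4y²` there).
[cite: AjankiHuveneers2011, §6.2 eq. (6.15)] -/
theorem integral_inv_one_add_sq_sin_le {lam : ℝ} (hlam : 0 < lam) :
    ∫ y in Set.Ico (0 : ℝ) 1, 1 / (1 + lam ^ 2 * Real.sin (π * y) ^ 2) ≤ π / (2 * lam) := by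
  set f : ℝ → ℝ := fun y => 1 / (1 + lam ^ 2 * Real.sin (π * y) ^ 2) with hf
  have hfc : Continuous f :=
    continuous_const.div (by fun_prop) fun y => by positivity
  have hper : Function.Periodic f 1 := fun y => by
    simp only [hf]
    rw [mul_add, mul_one, Real.sin_add_pi, neg_sq]
  have h1 : ∫ y in Set.Ico (0 : ℝ) 1, f y = ∫ y in (0 : ℝ)..1, f y := by
    rw [intervalIntegral.integral_of_le zero_le_one, integral_Ico_eq_integral_Ioc]
  have h2 : ∫ y in (0 : ℝ)..1, f y = ∫ y in (-(1 / 2 : ℝ))..(1 / 2), f y := by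
    have := hper.intervalIntegral_add_eq 0 (-(1 / 2 : ℝ))
    rw [zero_add, show -(1 / 2 : ℝ) + 1 = 1 / 2 by norm_num] at this
    exact this
  have hgc : Continuous fun y : ℝ => 1 / (1 + (2 * lam * y) ^ 2) :=
    continuous_const.div (by fun_prop) fun y => by positivity
  rw [h1, h2]
  calc ∫ y in (-(1 / 2 : ℝ))..(1 / 2), f y
      ≤ ∫ y in (-(1 / 2 : ℝ))..(1 / 2), 1 / (1 + (2 * lam * y) ^ 2) := by
        refine intervalIntegral.integral_mono_on (by norm_num) (hfc.intervalIntegrable _ _)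
          (hgc.intervalIntegrable _ _) fun y hy => ?_
        have hy' : |y| ≤ 1 / 2 := abs_le.mpr ⟨by linarith [hy.1], hy.2⟩
        have hj := Literature.Analysis.FunctionSpaces.Torus.two_mul_abs_le_abs_sin_pi_mul hy'
        have hsq : (2 * lam * y) ^ 2 ≤ lam ^ 2 * Real.sin (π * y) ^ 2 := by
          have h3 : (2 * |y|) ^ 2 ≤ |Real.sin (π * y)| ^ 2 :=
            pow_le_pow_left₀ (by positivity) hj 2
          rw [sq_abs] at h3
          calc (2 * lam * y) ^ 2 = lam ^ 2 * (2 * |y|) ^ 2 := by rw [mul_pow 2 |y|, sq_abs]; ring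
            _ ≤ lam ^ 2 * Real.sin (π * y) ^ 2 := mul_le_mul_of_nonneg_left h3 (sq_nonneg _)
        simp only [hf]
        exact one_div_le_one_div_of_le (by positivity) (by linarith)
    _ ≤ π / (2 * lam) := integral_lorentz_le hlam

/-! ### The cut-off functions of (6.14) -/

section Cut

/-! The two cut-offs of (6.14) enter only through their defining equations `hu₁`, `hu₂`:
`u₁ = 1_A`, `A = {a² sin²πy ≤ q}` (`q = L²w⁴`), is the first term `χ_{[0,1]}(w⁻⁴a² sin²πX_m)`
of (6.14), and `u₂ = 1_{A^c} · q/(a² sin²πy)` the second,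
`χ_{]1,∞[}(w⁻⁴a² sin²πX_m) · w⁴a⁻² sin⁻²πX_m`. -/

variable {q a : ℝ} {u₁ u₂ : ℝ → ℝ}

/-- `0 ≤ u₁ ≤ 1`. [folklore] -/
theorem cut₁_mem (hu₁ : ∀ y, u₁ y = if a ^ 2 * Real.sin (π * y) ^ 2 ≤ q then 1 else 0) (y : ℝ) :
    0 ≤ u₁ y ∧ u₁ y ≤ 1 := by
  rw [hu₁]
  split_ifs <;> norm_num

/-- `0 ≤ u₂ ≤ 1` (`q ≥ 0`). [folklore] -/
theorem cut₂_mem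
    (hu₂ : ∀ y, u₂ y = if a ^ 2 * Real.sin (π * y) ^ 2 ≤ q then 0 else q / (a ^ 2 * Real.sin (π * y) ^ 2))
    (hq : 0 ≤ q) (y : ℝ) : 0 ≤ u₂ y ∧ u₂ y ≤ 1 := by
  rw [hu₂]
  split_ifs with h
  · norm_num
  · have h := not_le.mp h
    have hpos : 0 < a ^ 2 * Real.sin (π * y) ^ 2 := hq.trans_lt h
    exact ⟨div_nonneg hq hpos.le, (div_le_one hpos).mpr h.le⟩

/-- `sin² π(y+1) = sin² πy`. [folklore] -/
theorem sin_pi_mul_add_one_sq (y : ℝ) : Real.sin (π * (y + 1)) ^ 2 = Real.sin (π * y) ^ 2 := by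
  rw [mul_add, mul_one, Real.sin_add_pi, neg_sq]

/-- `u₁` is a function on `𝕋`. [folklore] -/
theorem cut₁_periodic (hu₁ : ∀ y, u₁ y = if a ^ 2 * Real.sin (π * y) ^ 2 ≤ q then 1 else 0) :
    Function.Periodic u₁ 1 := fun y => by
  rw [hu₁, hu₁, sin_pi_mul_add_one_sq]

/-- `u₂` is a function on `𝕋`. [folklore] -/
theorem cut₂_periodic
    (hu₂ : ∀ y, u₂ y = if a ^ 2 * Real.sin (π * y) ^ 2 ≤ q then 0 else q / (a ^ 2 * Real.sin (π * y) ^ 2)) :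
    Function.Periodic u₂ 1 := fun y => by
  rw [hu₂, hu₂, sin_pi_mul_add_one_sq]

/-- `u₁` is Borel. [folklore] -/
theorem measurable_cut₁ (hu₁ : ∀ y, u₁ y = if a ^ 2 * Real.sin (π * y) ^ 2 ≤ q then 1 else 0) :
    Measurable u₁ := by
  rw [show u₁ = fun y => if a ^ 2 * Real.sin (π * y) ^ 2 ≤ q then (1 : ℝ) else 0 from funext hu₁]
  refine Measurable.ite ?_ measurable_const measurable_const
  exact measurableSet_le (by fun_prop) measurable_const

/-- `u₂` is Borel. [folklore] -/
theorem measurable_cut₂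
    (hu₂ : ∀ y, u₂ y = if a ^ 2 * Real.sin (π * y) ^ 2 ≤ q then 0 else q / (a ^ 2 * Real.sin (π * y) ^ 2)) :
    Measurable u₂ := by
  rw [show u₂ = fun y => if a ^ 2 * Real.sin (π * y) ^ 2 ≤ q then (0 : ℝ) else
    q / (a ^ 2 * Real.sin (π * y) ^ 2) from funext hu₂]
  refine Measurable.ite ?_ measurable_const (measurable_const.div (by fun_prop))
  exact measurableSet_le (by fun_prop) measurable_const

/-- `u₁ ∈ L¹(𝕋)`. [folklore] -/
theorem integrableOn_cut₁ (hu₁ : ∀ y, u₁ y = if a ^ 2 * Real.sin (π * y) ^ 2 ≤ q then 1 else 0) :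
    IntegrableOn u₁ (Set.Ico 0 1) := by
  refine Integrable.mono' (integrableOn_const (C := (1 : ℝ)) (by rw [Real.volume_Ico]; exact ENNReal.ofReal_ne_top))
    (measurable_cut₁ hu₁).aestronglyMeasurable (ae_of_all _ fun y => ?_)
  rw [Real.norm_eq_abs, abs_of_nonneg (cut₁_mem hu₁ y).1]
  exact (cut₁_mem hu₁ y).2

/-- `u₂ ∈ L¹(𝕋)` (`q ≥ 0`). [folklore] -/
theorem integrableOn_cut₂
    (hu₂ : ∀ y, u₂ y = if a ^ 2 * Real.sin (π * y) ^ 2 ≤ q then 0 else q / (a ^ 2 * Real.sin (π * y) ^ 2))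
    (hq : 0 ≤ q) : IntegrableOn u₂ (Set.Ico 0 1) := by
  refine Integrable.mono' (integrableOn_const (C := (1 : ℝ)) (by rw [Real.volume_Ico]; exact ENNReal.ofReal_ne_top))
    (measurable_cut₂ hu₂).aestronglyMeasurable (ae_of_all _ fun y => ?_)
  rw [Real.norm_eq_abs, abs_of_nonneg (cut₂_mem hu₂ hq y).1]
  exact (cut₂_mem hu₂ hq y).2

/-- **(6.14) pointwise**: "Because `h(r) ≤ 1` and `h(r) ≤ w⁴r⁻²` for every `r ∈ ℝ`, one has, for
every event `A`, the bound `h(aΓ^x_m sin πX^x_m) ≤ 1_A + 1_{A^c} · w⁴ · (aΓ^x_m sin πX^x_m)⁻²`",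
with `1_A = χ_{[0,1]}(w⁻⁴a² sin²πX^x_m)`; here `h = 1/(1 + a²Γ²sin²πy/q)`, `q = L²w⁴`, `Γ > 0`.
[cite: AjankiHuveneers2011, §6.2 eq. (6.14)] -/
theorem lorentz_le_cut (hu₁ : ∀ y, u₁ y = if a ^ 2 * Real.sin (π * y) ^ 2 ≤ q then 1 else 0)
    (hu₂ : ∀ y, u₂ y = if a ^ 2 * Real.sin (π * y) ^ 2 ≤ q then 0 else q / (a ^ 2 * Real.sin (π * y) ^ 2))
    (hq : 0 < q) {Γ : ℝ} (hΓ : 0 < Γ) (y : ℝ) :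
    1 / (1 + a ^ 2 * Γ ^ 2 * Real.sin (π * y) ^ 2 / q) ≤ u₁ y + u₂ y * (Γ ^ 2)⁻¹ := by
  rw [hu₁, hu₂]
  set t := a ^ 2 * Real.sin (π * y) ^ 2 with ht
  have ht0 : 0 ≤ t := by positivity
  have hid : a ^ 2 * Γ ^ 2 * Real.sin (π * y) ^ 2 = t * Γ ^ 2 := by rw [ht]; ring
  rw [hid]
  split_ifs with h
  · rw [zero_mul, add_zero, div_le_one (by positivity)]
    have : 0 ≤ t * Γ ^ 2 / q := by positivity
    linarith
  · have h := not_le.mp h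
    have htpos : 0 < t := hq.trans h
    rw [zero_add]
    calc 1 / (1 + t * Γ ^ 2 / q) ≤ 1 / (t * Γ ^ 2 / q) :=
          one_div_le_one_div_of_le (by positivity) (by linarith)
      _ = q / t * (Γ ^ 2)⁻¹ := by
          field_simp

/-- `u₁ + u₂ ≤ 2q/(q + a² sin²πy)` ("`≲ 1/(1 + w⁻⁴a² sin²πy)`", the second line of (6.15)).
[cite: AjankiHuveneers2011, §6.2 eq. (6.15)] -/
theorem cut_sum_le (hu₁ : ∀ y, u₁ y = if a ^ 2 * Real.sin (π * y) ^ 2 ≤ q then 1 else 0)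
    (hu₂ : ∀ y, u₂ y = if a ^ 2 * Real.sin (π * y) ^ 2 ≤ q then 0 else q / (a ^ 2 * Real.sin (π * y) ^ 2))
    (hq : 0 < q) (y : ℝ) :
    u₁ y + u₂ y ≤ 2 * (q / (q + a ^ 2 * Real.sin (π * y) ^ 2)) := by
  rw [hu₁, hu₂]
  set t := a ^ 2 * Real.sin (π * y) ^ 2 with ht
  have ht0 : 0 ≤ t := by positivity
  split_ifs with h
  · rw [add_zero, mul_div_assoc', le_div_iff₀ (by positivity)]
    linarith
  · have h := not_le.mp h
    have htpos : 0 < t := hq.trans h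
    rw [zero_add, mul_div_assoc', div_le_div_iff₀ htpos (by positivity)]
    nlinarith

/-- **The `y`-integral of `u₁ + u₂`**: `∫_𝕋 u₁ + ∫_𝕋 u₂ ≤ π√q/a` (`a > 0`), i.e. "`≲ w²a⁻¹`" for
`q = L²w⁴`. [cite: AjankiHuveneers2011, §6.2 eq. (6.15)] -/
theorem setIntegral_cut_le (hu₁ : ∀ y, u₁ y = if a ^ 2 * Real.sin (π * y) ^ 2 ≤ q then 1 else 0)
    (hu₂ : ∀ y, u₂ y = if a ^ 2 * Real.sin (π * y) ^ 2 ≤ q then 0 else q / (a ^ 2 * Real.sin (π * y) ^ 2))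
    (hq : 0 < q) (ha : 0 < a) :
    (∫ y in Set.Ico (0 : ℝ) 1, u₁ y) + ∫ y in Set.Ico (0 : ℝ) 1, u₂ y ≤ π * Real.sqrt q / a := by
  set lam : ℝ := a / Real.sqrt q with hlam
  have hsq : 0 < Real.sqrt q := Real.sqrt_pos.mpr hq
  have hlam0 : 0 < lam := by positivity
  have hlam2 : lam ^ 2 = a ^ 2 / q := by rw [hlam, div_pow, Real.sq_sqrt hq.le]
  have hg : ∀ y, q / (q + a ^ 2 * Real.sin (π * y) ^ 2) = 1 / (1 + lam ^ 2 * Real.sin (π * y) ^ 2) := by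
    intro y
    rw [hlam2]
    field_simp
  have hgc : Continuous fun y : ℝ => 2 * (1 / (1 + lam ^ 2 * Real.sin (π * y) ^ 2)) :=
    continuous_const.mul (continuous_const.div (by fun_prop) fun y => by positivity)
  have hgi : IntegrableOn (fun y : ℝ => 2 * (1 / (1 + lam ^ 2 * Real.sin (π * y) ^ 2))) (Set.Ico 0 1) :=
    (hgc.integrableOn_Icc (μ := volume) (a := 0) (b := 1)).mono_set Set.Ico_subset_Icc_self
  rw [← integral_add (integrableOn_cut₁ hu₁) (integrableOn_cut₂ hu₂ hq.le)]
  calc ∫ y in Set.Ico (0 : ℝ) 1, u₁ y + u₂ y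
      ≤ ∫ y in Set.Ico (0 : ℝ) 1, 2 * (1 / (1 + lam ^ 2 * Real.sin (π * y) ^ 2)) := by
        refine setIntegral_mono_on ((integrableOn_cut₁ hu₁).add (integrableOn_cut₂ hu₂ hq.le)) hgi
          measurableSet_Ico fun y _ => ?_
        rw [← hg y]
        exact cut_sum_le hu₁ hu₂ hq y
    _ = 2 * ∫ y in Set.Ico (0 : ℝ) 1, 1 / (1 + lam ^ 2 * Real.sin (π * y) ^ 2) := integral_const_mul _ _
    _ ≤ 2 * (π / (2 * lam)) :=
        mul_le_mul_of_nonneg_left (integral_inv_one_add_sq_sin_le hlam0) zero_le_two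
    _ = π * Real.sqrt q / a := by
        rw [hlam]
        field_simp

end Cut

/-! ### `Γ_m⁻² ≲ e^{w∑h₂(X_{k-1})B_k}` for `w²m ≤ 1`, `h₂ = -2s = π sin 2π·`, from (3.21) -/

/-- `|π sin 2πy| ≤ π`: the weight `h₂ = -2s = π sin 2π·` against which Prop. 5.1 is applied to
control `Γ_m⁻²` is bounded. [folklore] -/
theorem abs_pi_mul_sin_le (y : ℝ) : |π * Real.sin (2 * π * y)| ≤ π := by
  rw [abs_mul, abs_of_pos Real.pi_pos]
  exact mul_le_of_le_one_right Real.pi_pos.le (Real.abs_sin_le_one _)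

/-- `h₂ = π sin 2π·` is a function on `𝕋`. [folklore] -/
theorem periodic_pi_mul_sin : Function.Periodic (fun y : ℝ => π * Real.sin (2 * π * y)) 1 := fun y => by
  simp only
  rw [show 2 * π * (y + 1) = 2 * π * y + 2 * π by ring, Real.sin_add_two_pi]

/-- `h₂ = π sin 2π· ∈ C¹(𝕋)`. [folklore] -/
theorem contDiff_pi_mul_sin : ContDiff ℝ 1 (fun y : ℝ => π * Real.sin (2 * π * y)) := by
  fun_prop

/-- `|r(x)| ≤ π²/2`. [folklore] -/
theorem abs_ahR_le (x : ℝ) : |ahR x| ≤ π ^ 2 / 2 := by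
  unfold ahR
  have hc := abs_le.mp (Real.abs_cos_le_one (2 * π * x))
  have h1 : |Real.cos (2 * π * x) ^ 2 - Real.cos (2 * π * x)| ≤ 2 := by
    rw [abs_le]
    constructor <;> nlinarith [sq_nonneg (Real.cos (2 * π * x))]
  rw [abs_mul, abs_of_pos (by positivity : (0 : ℝ) < π ^ 2 / 4)]
  nlinarith [Real.pi_pos, abs_nonneg (Real.cos (2 * π * x) ^ 2 - Real.cos (2 * π * x))]

/-- **`Γ_m⁻² ≤ E₀ e^{w∑_{k<m} h₂(X_k)B_{k+1}}` for `w²m ≤ 1`**, `h₂ = -2s`: from (3.21),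
`-2 log Γ^x_m ≤ -2∑_{l=1}^{m-1}(w s(X_l)B_{l+1} + w²r(X_l)B_{l+1}²) + 2Cw³m`, where
`2w²∑|r|B² ≤ π²b_*²` and `2Cw³m ≤ 2C` for `w²m ≤ 1`, `w ≤ 1`, and the `k = 0` term
`w h₂(x)B_1` costs at most `πb_*` (`b_* = max(|b₋|,|b₊|)`). This is the step "`Γ_m⁻² ≲
e^{w∑h(X)B}`" implicit in the application of Prop. 5.1 in (6.15).
[cite: AjankiHuveneers2011, §6.2 eq. (6.15) with Prop. 3.5 eq. (3.21)] -/
theorem ahGamma_inv_sq_le (bm bp : ℝ) (hbm : -1 < bm) (hlt : bm < bp) :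
    ∃ w₀ : ℝ, 0 < w₀ ∧ ∃ E₀ : ℝ, 1 ≤ E₀ ∧ ∀ w ∈ Set.Ioc 0 w₀, ∀ x : ℝ, ∀ B : ℕ → ℝ,
      (∀ k, B k ∈ Set.Icc bm bp) → ∀ m : ℕ, w ^ 2 * m ≤ 1 →
        0 < ahGamma w x B m ∧
          ((ahGamma w x B m) ^ 2)⁻¹ ≤
            E₀ * Real.exp (w * ∑ k ∈ Finset.range m, π * Real.sin (2 * π * ahPhase w x B k) * B k) := by
  obtain ⟨w₄, hw₄, C₄, hC⟩ := AjankiHuveneers2011_logGammaExpansion_holds bm bp hbm hlt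
  obtain ⟨M, hM⟩ : ∃ M : ℝ, M = max |bm| |bp| := ⟨_, rfl⟩
  have hM0 : 0 ≤ M := hM ▸ le_max_of_le_left (abs_nonneg _)
  set c₀ : ℝ := π * M + π ^ 2 * M ^ 2 + 2 * |C₄| with hc₀
  have hc₀0 : 0 ≤ c₀ := by positivity
  refine ⟨min w₄ 1, by positivity, Real.exp c₀, Real.one_le_exp hc₀0, ?_⟩
  intro w hw x B hB m hm
  have hw0 : 0 < w := hw.1
  have hw4 : w ∈ Set.Ioc 0 w₄ := ⟨hw0, hw.2.trans (min_le_left _ _)⟩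
  have hw1 : w ≤ 1 := hw.2.trans (min_le_right _ _)
  obtain ⟨hpos, hlog⟩ := hC w hw4 x B hB m
  refine ⟨hpos, ?_⟩
  have hΓ : ((ahGamma w x B m) ^ 2)⁻¹ = Real.exp (-(2 * Real.log (ahGamma w x B m))) := by
    rw [Real.exp_neg, two_mul, Real.exp_add, Real.exp_log hpos, sq]
  rw [hΓ, ← Real.exp_add, Real.exp_le_exp]
  -- the bookkeeping
  have hBabs : ∀ k, |B k| ≤ M := fun k => hM ▸ abs_le_max_abs_abs (hB k).1 (hB k).2
  have hBsq : ∀ k, B k ^ 2 ≤ M ^ 2 := fun k => by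
    rw [← sq_abs]; exact pow_le_pow_left₀ (abs_nonneg _) (hBabs k) 2
  set T := ∑ l ∈ Finset.Ico 1 m,
    (w * ahS (ahPhase w x B l) * B l + w ^ 2 * ahR (ahPhase w x B l) * B l ^ 2) with hT
  have hlog' : -(2 * Real.log (ahGamma w x B m)) ≤ -2 * T + 2 * |C₄| := by
    have h1 := (abs_le.mp hlog).1
    have h2 : C₄ * w ^ 3 * m ≤ |C₄| := by
      have hwm0 : 0 ≤ w ^ 3 * (m : ℝ) := by positivity
      calc C₄ * w ^ 3 * m = C₄ * (w ^ 3 * m) := by ring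
        _ ≤ |C₄| * (w ^ 3 * m) := mul_le_mul_of_nonneg_right (le_abs_self C₄) hwm0
        _ = |C₄| * w * (w ^ 2 * m) := by ring
        _ ≤ |C₄| * w * 1 := mul_le_mul_of_nonneg_left hm (mul_nonneg (abs_nonneg _) hw0.le)
        _ ≤ |C₄| * 1 * 1 := by
            refine mul_le_mul_of_nonneg_right ?_ zero_le_one
            exact mul_le_mul_of_nonneg_left hw1 (abs_nonneg _)
        _ = |C₄| := by ring
    linarith
  -- `-2T = w∑_{Ico 1 m} h₂(X_l)B_l - 2w²∑_{Ico 1 m} r(X_l)B_l²`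
  have hTsplit : -2 * T = w * ∑ l ∈ Finset.Ico 1 m, π * Real.sin (2 * π * ahPhase w x B l) * B l +
      ∑ l ∈ Finset.Ico 1 m, (-2) * (w ^ 2 * ahR (ahPhase w x B l) * B l ^ 2) := by
    rw [hT, Finset.mul_sum, Finset.mul_sum, ← Finset.sum_add_distrib]
    refine Finset.sum_congr rfl fun l _ => ?_
    simp only [ahS]
    ring
  have hRsum : ∑ l ∈ Finset.Ico 1 m, (-2) * (w ^ 2 * ahR (ahPhase w x B l) * B l ^ 2) ≤ π ^ 2 * M ^ 2 := by
    calc ∑ l ∈ Finset.Ico 1 m, (-2) * (w ^ 2 * ahR (ahPhase w x B l) * B l ^ 2)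
        ≤ ∑ _l ∈ Finset.Ico 1 m, w ^ 2 * (π ^ 2 * M ^ 2) := by
          refine Finset.sum_le_sum fun l _ => ?_
          have hr := abs_le.mp (abs_ahR_le (ahPhase w x B l))
          have hb := hBsq l
          have hb0 : 0 ≤ B l ^ 2 := sq_nonneg _
          nlinarith [mul_le_mul_of_nonneg_left hb (sq_nonneg w), Real.pi_pos,
            mul_nonneg (sq_nonneg w) hb0]
      _ = (m - 1 : ℕ) * (w ^ 2 * (π ^ 2 * M ^ 2)) := by
          rw [Finset.sum_const, Nat.card_Ico, nsmul_eq_mul]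
      _ ≤ m * (w ^ 2 * (π ^ 2 * M ^ 2)) := by
          gcongr
          exact Nat.sub_le m 1
      _ = (w ^ 2 * m) * (π ^ 2 * M ^ 2) := by ring
      _ ≤ 1 * (π ^ 2 * M ^ 2) := mul_le_mul_of_nonneg_right hm (by positivity)
      _ = π ^ 2 * M ^ 2 := one_mul _
  have hHsum : w * ∑ l ∈ Finset.Ico 1 m, π * Real.sin (2 * π * ahPhase w x B l) * B l ≤
      w * ∑ k ∈ Finset.range m, π * Real.sin (2 * π * ahPhase w x B k) * B k + π * M := by
    rcases Nat.eq_zero_or_pos m with hm0 | hmpos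
    · subst hm0
      simp only [show Finset.Ico 1 0 = ∅ from Finset.Ico_eq_empty_of_le (by norm_num),
        Finset.sum_empty, mul_zero, Finset.range_zero, zero_add]
      positivity
    · rw [Finset.range_eq_Ico, Finset.sum_eq_sum_Ico_succ_bot hmpos]
      have h0 : -(w * (π * Real.sin (2 * π * ahPhase w x B 0) * B 0)) ≤ π * M := by
        set t := π * Real.sin (2 * π * ahPhase w x B 0) * B 0 with ht
        have h1 : |t| ≤ π * M := by
          rw [ht, abs_mul]
          exact mul_le_mul (abs_pi_mul_sin_le _) (hBabs 0) (abs_nonneg _) Real.pi_pos.le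
        calc -(w * t) = w * (-t) := by ring
          _ ≤ w * |t| := mul_le_mul_of_nonneg_left (neg_le_abs t) hw0.le
          _ ≤ 1 * |t| := mul_le_mul_of_nonneg_right hw1 (abs_nonneg t)
          _ ≤ π * M := by rw [one_mul]; exact h1
      rw [mul_add]
      linarith
  calc -(2 * Real.log (ahGamma w x B m)) ≤ -2 * T + 2 * |C₄| := hlog'
    _ = w * ∑ l ∈ Finset.Ico 1 m, π * Real.sin (2 * π * ahPhase w x B l) * B l +
          ∑ l ∈ Finset.Ico 1 m, (-2) * (w ^ 2 * ahR (ahPhase w x B l) * B l ^ 2) + 2 * |C₄| := by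
        rw [hTsplit]
    _ ≤ (w * ∑ k ∈ Finset.range m, π * Real.sin (2 * π * ahPhase w x B k) * B k + π * M) + π ^ 2 * M ^ 2 + 2 * |C₄| := by
        linarith
    _ = c₀ + w * ∑ k ∈ Finset.range m, π * Real.sin (2 * π * ahPhase w x B k) * B k := by
        rw [hc₀]
        ring

/-! ### Disorder sequences in `[b₋, b₊]` -/

/-- All coordinates of `finExt β`, padding zeros included, lie in `[b₋, b₊]` when `β` does
(`b₋ ≤ 0 ≤ b₊`). [folklore] -/
theorem finExt_mem_Icc {bm bp : ℝ} (hbm : bm ≤ 0) (hbp : 0 ≤ bp) {n : ℕ} {β : Fin n → ℝ}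
    (hβ : ∀ i, bm ≤ β i ∧ β i ≤ bp) (k : ℕ) : finExt β k ∈ Set.Icc bm bp := by
  by_cases hk : k < n
  · rw [finExt_of_lt _ hk]
    exact ⟨(hβ _).1, (hβ _).2⟩
  · unfold finExt
    rw [dif_neg hk]
    exact ⟨hbm, hbp⟩

/-- Joining two blocks of disorder in `[b₋, b₊]` stays in `[b₋, b₊]`. [folklore] -/
theorem append_mem_Icc {bm bp : ℝ} {r m : ℕ} {β : Fin r → ℝ} {β' : Fin m → ℝ}
    (hβ : ∀ i, bm ≤ β i ∧ β i ≤ bp) (hβ' : ∀ j, bm ≤ β' j ∧ β' j ≤ bp) :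
    ∀ i, bm ≤ Fin.append β β' i ∧ Fin.append β β' i ≤ bp := by
  intro i
  induction i using Fin.addCases with
  | left i => rw [Fin.append_left]; exact hβ i
  | right j => rw [Fin.append_right]; exact hβ' j

/-! ### (6.14)–(6.15): the conditional expectation, given Prop. 5.1 -/

/-- **The core of (6.13)–(6.15)**, for a fixed starting point `x` and amplitude `a > 0` of the
restarted chain: "`𝔼(j_n(w) | x, a) ≲ 𝔼{χ_{[0,1]}(w⁻⁴a² sin²πX^x_m) + χ_{]1,∞[}(w⁻⁴a² sin²πX^x_m)
· w⁴ · (aΓ^x_m sin πX^x_m)⁻²}`. Therefore, Proposition 5.1 implies `𝔼(j_n(w) | x, a) ≲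
(1/(w√m)) ∫_𝕋 {…} dy ≲ … ≲ (w/√m) a⁻¹`" — here for the kernel `1/(1 + a²Γ²sin²πX_m/(L²w⁴))`,
under `κ ≤ wm`, `w²m ≤ 1`, with Prop. 5.1 (`AjankiHuveneers2011_potentialTheory`) as a
HYPOTHESIS, applied with `h ≡ 0`, `u = u₁` and with `h = h₂ = -2s`, `u = u₂`
(`Γ_m⁻² ≤ E₀e^{w∑h₂(X)B}`, `ahGamma_inv_sq_le`). The majorant `G` is returned together with its
integrability (part of Prop. 5.1's conclusion). [cite: AjankiHuveneers2011, §6.2 eqs. (6.14)-(6.15)] -/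
theorem pointwise_core (h5 : AjankiHuveneers2011_potentialTheory) {τ : ℝ → ℝ} {bm bp : ℝ}
    (hτ : ReducedLawHyp τ bm bp) (ρB : Measure ℝ) [IsProbabilityMeasure ρB]
    (hρ : ρB = volume.withDensity fun s => ENNReal.ofReal (τ s)) {κ : ℝ} (hκ : 0 < κ) {L : ℝ}
    (hL : 0 < L) :
    ∃ w₀ : ℝ, 0 < w₀ ∧ ∃ K₀ : ℝ, 0 < K₀ ∧ ∀ w ∈ Set.Ioc 0 w₀, ∀ m : ℕ, κ ≤ w * m →
      w ^ 2 * m ≤ 1 → ∀ x a : ℝ, 0 < a →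
        ∃ G : (Fin m → ℝ) → ℝ, Integrable G (Measure.pi fun _ : Fin m => ρB) ∧
          (∀ᵐ β ∂(Measure.pi fun _ : Fin m => ρB),
            1 / (1 + a ^ 2 * (ahGamma w x (finExt β) m) ^ 2 *
              Real.sin (π * ahPhase w x (finExt β) m) ^ 2 / (L ^ 2 * w ^ 4)) ≤ G β) ∧
          ∫ β, G β ∂(Measure.pi fun _ : Fin m => ρB) ≤ K₀ * w / (Real.sqrt m * a) := by
  obtain ⟨K₁, K₁', w₁, hK₁, -, hw₁, h51⟩ :=
    h5 τ bm bp hτ ρB hρ κ hκ (fun _ => 0) (fun _ => rfl) contDiff_const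
  obtain ⟨K₂, K₂', w₂, hK₂, -, hw₂, h52⟩ :=
    h5 τ bm bp hτ ρB hρ κ hκ (fun y : ℝ => π * Real.sin (2 * π * y)) periodic_pi_mul_sin
      contDiff_pi_mul_sin
  obtain ⟨w₆, hw₆, E₀, hE₀, hE⟩ := ahGamma_inv_sq_le bm bp hτ.lo hτ.lt
  have hE₀0 : 0 ≤ E₀ := zero_le_one.trans hE₀
  refine ⟨min (min w₁ w₂) w₆, by positivity, (K₁ + E₀ * K₂) * (π * L), by positivity, ?_⟩
  intro w hw m hκm hwm x a ha
  have hw0 : 0 < w := hw.1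
  have hw1 : w ∈ Set.Ioc 0 w₁ := ⟨hw0, hw.2.trans ((min_le_left _ _).trans (min_le_left _ _))⟩
  have hw2 : w ∈ Set.Ioc 0 w₂ := ⟨hw0, hw.2.trans ((min_le_left _ _).trans (min_le_right _ _))⟩
  have hw6 : w ∈ Set.Ioc 0 w₆ := ⟨hw0, hw.2.trans (min_le_right _ _)⟩
  have hm0 : (0 : ℝ) < m := by
    have h : 0 < w * m := hκ.trans_le hκm
    exact pos_of_mul_pos_right h hw0.le
  have hsm : 0 < Real.sqrt m := Real.sqrt_pos.mpr hm0
  set q : ℝ := L ^ 2 * w ^ 4 with hq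
  have hq0 : 0 < q := by positivity
  have hsqrtq : Real.sqrt q = L * w ^ 2 := by
    rw [hq, show L ^ 2 * w ^ 4 = (L * w ^ 2) ^ 2 by ring, Real.sqrt_sq (by positivity)]
  -- the two cut-offs of (6.14)
  set u₁ : ℝ → ℝ := fun y => if a ^ 2 * Real.sin (π * y) ^ 2 ≤ q then 1 else 0 with hu₁def
  set u₂ : ℝ → ℝ := fun y => if a ^ 2 * Real.sin (π * y) ^ 2 ≤ q then 0 else
    q / (a ^ 2 * Real.sin (π * y) ^ 2) with hu₂def
  have hu₁ : ∀ y, u₁ y = if a ^ 2 * Real.sin (π * y) ^ 2 ≤ q then 1 else 0 := fun y => rfl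
  have hu₂ : ∀ y, u₂ y = if a ^ 2 * Real.sin (π * y) ^ 2 ≤ q then 0 else
      q / (a ^ 2 * Real.sin (π * y) ^ 2) := fun y => rfl
  obtain ⟨hI₁, hB₁⟩ := (h51 w hw1 u₁ (cut₁_periodic hu₁)
    (fun y => (cut₁_mem hu₁ y).1) (integrableOn_cut₁ hu₁) x m).1 hκm hwm
  obtain ⟨hI₂, hB₂⟩ := (h52 w hw2 u₂ (cut₂_periodic hu₂)
    (fun y => (cut₂_mem hu₂ hq0.le y).1) (integrableOn_cut₂ hu₂ hq0.le) x m).1 hκm hwm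
  set G₁ : (Fin m → ℝ) → ℝ := fun B =>
    Real.exp (w * ∑ k ∈ Finset.range m, (fun _ => (0 : ℝ)) (ahPhase w x (finExt B) k) * finExt B k) *
      u₁ (ahPhase w x (finExt B) m) with hG₁
  set G₂ : (Fin m → ℝ) → ℝ := fun B =>
    Real.exp (w * ∑ k ∈ Finset.range m, π * Real.sin (2 * π * ahPhase w x (finExt B) k) * finExt B k) *
      u₂ (ahPhase w x (finExt B) m) with hG₂
  refine ⟨fun B => G₁ B + E₀ * G₂ B, hI₁.add (hI₂.const_mul E₀), ?_, ?_⟩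
  · filter_upwards [ae_pi_mem_Icc hτ.eq_zero hρ m] with β hβ
    have hBk : ∀ k, finExt β k ∈ Set.Icc bm bp := finExt_mem_Icc hτ.bm_nonpos hτ.bp_nonneg hβ
    obtain ⟨hΓpos, hΓ⟩ := hE w hw6 x (finExt β) hBk m hwm
    have hG₁β : G₁ β = u₁ (ahPhase w x (finExt β) m) := by
      simp [hG₁]
    have h1 := lorentz_le_cut hu₁ hu₂ hq0 hΓpos (ahPhase w x (finExt β) m)
    have hu₂0 := (cut₂_mem hu₂ hq0.le (ahPhase w x (finExt β) m)).1
    calc 1 / (1 + a ^ 2 * (ahGamma w x (finExt β) m) ^ 2 *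
          Real.sin (π * ahPhase w x (finExt β) m) ^ 2 / (L ^ 2 * w ^ 4))
        ≤ u₁ (ahPhase w x (finExt β) m) +
            u₂ (ahPhase w x (finExt β) m) * ((ahGamma w x (finExt β) m) ^ 2)⁻¹ := h1
      _ ≤ u₁ (ahPhase w x (finExt β) m) +
            u₂ (ahPhase w x (finExt β) m) *
              (E₀ * Real.exp (w * ∑ k ∈ Finset.range m,
                π * Real.sin (2 * π * ahPhase w x (finExt β) k) * finExt β k)) :=
          add_le_add le_rfl (mul_le_mul_of_nonneg_left hΓ hu₂0)
      _ = G₁ β + E₀ * G₂ β := by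
          rw [hG₁β, hG₂]
          ring
  · have hX : 0 ≤ ∫ y in Set.Ico (0 : ℝ) 1, u₁ y :=
      setIntegral_nonneg measurableSet_Ico fun y _ => (cut₁_mem hu₁ y).1
    have hY : 0 ≤ ∫ y in Set.Ico (0 : ℝ) 1, u₂ y :=
      setIntegral_nonneg measurableSet_Ico fun y _ => (cut₂_mem hu₂ hq0.le y).1
    have hsum := setIntegral_cut_le hu₁ hu₂ hq0 ha
    have hc1 : 0 ≤ K₁ / (w * Real.sqrt m) := by positivity
    have hc2 : 0 ≤ K₂ / (w * Real.sqrt m) := by positivity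
    show ∫ B, G₁ B + E₀ * G₂ B ∂(Measure.pi fun _ : Fin m => ρB) ≤ _
    rw [integral_add hI₁ (hI₂.const_mul E₀), integral_const_mul]
    calc (∫ B, G₁ B ∂(Measure.pi fun _ : Fin m => ρB)) + E₀ * ∫ B, G₂ B ∂(Measure.pi fun _ : Fin m => ρB)
        ≤ K₁ / (w * Real.sqrt m) * (∫ y in Set.Ico (0 : ℝ) 1, u₁ y) +
            E₀ * (K₂ / (w * Real.sqrt m) * ∫ y in Set.Ico (0 : ℝ) 1, u₂ y) :=
          add_le_add hB₁ (mul_le_mul_of_nonneg_left hB₂ hE₀0)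
      _ ≤ (K₁ + E₀ * K₂) / (w * Real.sqrt m) *
            ((∫ y in Set.Ico (0 : ℝ) 1, u₁ y) + ∫ y in Set.Ico (0 : ℝ) 1, u₂ y) := by
          rw [add_div, add_mul, mul_add, mul_add]
          have h1 : 0 ≤ K₁ / (w * Real.sqrt m) * ∫ y in Set.Ico (0 : ℝ) 1, u₂ y :=
            mul_nonneg hc1 hY
          have h2 : 0 ≤ E₀ * K₂ / (w * Real.sqrt m) * ∫ y in Set.Ico (0 : ℝ) 1, u₁ y := by
            positivity
          have h3 : E₀ * (K₂ / (w * Real.sqrt m) * ∫ y in Set.Ico (0 : ℝ) 1, u₂ y) =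
              E₀ * K₂ / (w * Real.sqrt m) * ∫ y in Set.Ico (0 : ℝ) 1, u₂ y := by ring
          linarith
      _ ≤ (K₁ + E₀ * K₂) / (w * Real.sqrt m) * (π * Real.sqrt q / a) :=
          mul_le_mul_of_nonneg_left hsum (by positivity)
      _ = (K₁ + E₀ * K₂) * (π * L) * w / (Real.sqrt m * a) := by
          rw [hsqrtq]
          field_simp

/-! ### (6.11): Cor. 3.6 turned into `w²/(w² + D_n²) ≤ 1/(1 + a²Γ²S²/((6π)²w⁴))` -/

/-- **Cor. 3.6 as a lower bound on `|D_n(e₁)|`**, valid for every disorder sequence in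
`[b₋, b₊]^ℕ` and `0 < w ≤ smallFreq`: `Γ^ϑ_n ≥ 0` and `Γ^ϑ_n |sin πX^ϑ_n| ≤ 3πw |D_n(e₁)|` (from
`D_n sin πϑ = ρ_1 Γ^ϑ_n sin πX^ϑ_n`, `ρ_1 ≥ 1/3`, `sin πϑ ≤ πw`) — the content of
"`1/(1 + w⁻²D_n²(e₁)) ≲ h(Γ^ϑ_n sin πX^ϑ_n)`, `h(r) = 1/(1 + w⁻⁴r²)`" in (6.11).
[cite: AjankiHuveneers2011, Cor. 3.6 eq. (3.22) and §6.2 eq. (6.11)] -/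
theorem ahD_e₁_lower {bm bp w : ℝ} (hw0 : 0 < w) (hw : w ≤ smallFreq bm bp) {B : ℕ → ℝ}
    (hBk : ∀ k, B k ∈ Set.Icc bm bp) {n : ℕ} (hn : 1 ≤ n) :
    0 ≤ ahGamma w (ahTheta w) B n ∧
      ahGamma w (ahTheta w) B n * |Real.sin (π * ahPhase w (ahTheta w) B n)| ≤
        3 * (π * w) * |ahD (ahDiag w B) 1 0 n| := by
  obtain ⟨-, hB⟩ := small_of_le_smallFreq hw hBk
  obtain ⟨hρ0, h0⟩ := ahZeta_e₁_zero w B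
  have hmain := ahD_mul_sin_eq hw0 hB h0 n
  have hρpos : 0 < ahAmp w B 1 0 0 := by rw [hρ0]; exact one_pos
  have hρn := ahAmp_eq_mul_ahGamma hw0 hB h0 hρpos hn
  have hρ1 : 1 / 3 ≤ ahAmp w B 1 0 1 := by
    have h := (ahAmp_succ_bounds hw0 hB h0 0).1
    obtain ⟨-, hδ⟩ := abs_ahDelta_le hw0 (hB 0)
    rw [hρ0, mul_one] at h
    linarith
  have hπw : π * w ≤ 1 / 2 := (ahSmall_consequences hw0 (hB 0)).1
  obtain ⟨hsinlo, hsinle⟩ := sin_pi_mul_ahTheta_bounds hw0.le hπw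
  have hsinpos : 0 < Real.sin (π * ahTheta w) := by
    have : 0 < 3 / 4 * (π * w) := by positivity
    linarith
  have hρn0 : 0 ≤ ahAmp w B 1 0 n := ahAmp_nonneg _ _ _ _ _
  have hΓ0 : 0 ≤ ahGamma w (ahTheta w) B n := by
    by_contra hneg
    have hneg' : ahGamma w (ahTheta w) B n < 0 := not_le.mp hneg
    have : ahAmp w B 1 0 1 * ahGamma w (ahTheta w) B n < 0 :=
      mul_neg_of_pos_of_neg (by linarith) hneg'
    linarith [hρn]
  refine ⟨hΓ0, ?_⟩
  have habs : |ahD (ahDiag w B) 1 0 n| * Real.sin (π * ahTheta w) =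
      ahAmp w B 1 0 1 * ahGamma w (ahTheta w) B n * |Real.sin (π * ahPhase w (ahTheta w) B n)| := by
    have h := congrArg abs hmain
    rw [abs_mul, abs_mul, abs_of_pos hsinpos, abs_of_nonneg hρn0, hρn] at h
    exact h
  set S := |Real.sin (π * ahPhase w (ahTheta w) B n)| with hS
  set Γ := ahGamma w (ahTheta w) B n with hΓ
  set D := |ahD (ahDiag w B) 1 0 n| with hD
  have hS0 : 0 ≤ S := abs_nonneg _
  have hD0 : 0 ≤ D := abs_nonneg _
  have hΓS : 0 ≤ Γ * S := mul_nonneg hΓ0 hS0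
  calc Γ * S = 3 * ((1 / 3) * (Γ * S)) := by ring
    _ ≤ 3 * (ahAmp w B 1 0 1 * (Γ * S)) :=
        mul_le_mul_of_nonneg_left (mul_le_mul_of_nonneg_right hρ1 hΓS) (by norm_num)
    _ = 3 * (D * Real.sin (π * ahTheta w)) := by rw [habs]; ring
    _ ≤ 3 * (D * (π * w)) :=
        mul_le_mul_of_nonneg_left (mul_le_mul_of_nonneg_left hsinle hD0) (by norm_num)
    _ = 3 * (π * w) * D := by ring

/-- From `aΓ|S| ≤ 6πw|D|` to `w²/(w² + D²) ≤ 1/(1 + a²Γ²S²/((6π)²w⁴))`. [folklore] -/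
theorem majorant_le_lorentz {w a Γ S D : ℝ} (hw : 0 < w) (h0 : 0 ≤ a * Γ * |S|)
    (h : a * Γ * |S| ≤ 6 * (π * w) * |D|) :
    w ^ 2 / (w ^ 2 + D ^ 2) ≤ 1 / (1 + a ^ 2 * Γ ^ 2 * S ^ 2 / ((6 * π) ^ 2 * w ^ 4)) := by
  have hπ := Real.pi_pos
  have h2 : (a * Γ * |S|) ^ 2 ≤ (6 * (π * w) * |D|) ^ 2 := pow_le_pow_left₀ h0 h 2
  have key : a ^ 2 * Γ ^ 2 * S ^ 2 ≤ 36 * π ^ 2 * w ^ 2 * D ^ 2 := by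
    have e1 : (a * Γ * |S|) ^ 2 = a ^ 2 * Γ ^ 2 * S ^ 2 := by rw [mul_pow, mul_pow, sq_abs]
    have e2 : (6 * (π * w) * |D|) ^ 2 = 36 * π ^ 2 * w ^ 2 * D ^ 2 := by
      rw [mul_pow, mul_pow, mul_pow, sq_abs]; ring
    rw [e1, e2] at h2
    exact h2
  rw [div_le_div_iff₀ (by positivity) (by positivity), one_mul]
  have hX : w ^ 2 * (a ^ 2 * Γ ^ 2 * S ^ 2 / ((6 * π) ^ 2 * w ^ 4)) ≤ D ^ 2 := by
    rw [mul_div_assoc', div_le_iff₀ (by positivity)]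
    calc w ^ 2 * (a ^ 2 * Γ ^ 2 * S ^ 2) ≤ w ^ 2 * (36 * π ^ 2 * w ^ 2 * D ^ 2) :=
          mul_le_mul_of_nonneg_left key (sq_nonneg w)
      _ = D ^ 2 * ((6 * π) ^ 2 * w ^ 4) := by ring
  rw [mul_add, mul_one]
  linarith

/-- `w²/(w² + D_n²) ≤ 1/(1 + Γ^ϑ_n² sin²πX^ϑ_n/((6π)²w⁴))`: the bound (6.11) for the chain
started at `ϑ` (the case `m = n` of (6.13), no conditioning: `x = ϑ`, `a = 1`).
[cite: AjankiHuveneers2011, §6.2 eq. (6.11)] -/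
theorem majorant_le_start {bm bp w : ℝ} (hw0 : 0 < w) (hw : w ≤ smallFreq bm bp) (hbm : bm ≤ 0)
    (hbp : 0 ≤ bp) {n : ℕ} (hn : 1 ≤ n) (β : Fin n → ℝ) (hβ : ∀ i, bm ≤ β i ∧ β i ≤ bp) :
    w ^ 2 / (w ^ 2 + (ahD (ahDiag w (finExt β)) 1 0 n) ^ 2) ≤
      1 / (1 + (1 : ℝ) ^ 2 * (ahGamma w (ahTheta w) (finExt β) n) ^ 2 *
        Real.sin (π * ahPhase w (ahTheta w) (finExt β) n) ^ 2 / ((6 * π) ^ 2 * w ^ 4)) := by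
  obtain ⟨hΓ0, hlow⟩ := ahD_e₁_lower hw0 hw (finExt_mem_Icc hbm hbp hβ) hn
  refine majorant_le_lorentz hw0 (by positivity) ?_
  rw [one_mul]
  have hD := abs_nonneg (ahD (ahDiag w (finExt β)) 1 0 n)
  calc ahGamma w (ahTheta w) (finExt β) n * |Real.sin (π * ahPhase w (ahTheta w) (finExt β) n)|
      ≤ 3 * (π * w) * |ahD (ahDiag w (finExt β)) 1 0 n| := hlow
    _ ≤ 6 * (π * w) * |ahD (ahDiag w (finExt β)) 1 0 n| := by
        have : 0 ≤ π * w * |ahD (ahDiag w (finExt β)) 1 0 n| := by positivity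
        linarith

/-- **(6.11) after conditioning on the first `r` steps, (6.13)**: for `r, m ≥ 1` and disorder
`β ⧺ β'` in `[b₋, b₊]^{r+m}`, with `x = X^ϑ_r(β)`, `a = Γ^ϑ_r(β)`:
`w²/(w² + D_{r+m}(e₁)²) ≤ 1/(1 + a²Γ^x_m(β')² sin²πX^x_m(β')/((6π)²w⁴))` — "`𝔼(j_n(w)|x,a) ≲
𝔼 h(aΓ^x_m sin πX^x_m)`, since `Γ^ϑ_n = Γ^ϑ_{n-m} ∏_{l=n-m+1}^n g(X^ϑ_{l-1}, B_l)`" (the factor at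
the restart point is `≥ e^{-Cw} ≥ 1/2`). Also: all `Γ^x_k > 0` in this range of `w`.
[cite: AjankiHuveneers2011, §6.2 eqs. (6.11), (6.13)] -/
theorem majorant_append_le (bm bp : ℝ) (hbm : bm ≤ 0) (hbp : 0 ≤ bp) :
    ∃ w₀ : ℝ, 0 < w₀ ∧ ∀ w ∈ Set.Ioc 0 w₀,
      (∀ (x : ℝ) (k : ℕ) (B : ℕ → ℝ), (∀ j, B j ∈ Set.Icc bm bp) → 0 < ahGamma w x B k) ∧
      ∀ r m : ℕ, 1 ≤ r → 1 ≤ m → ∀ (β : Fin r → ℝ) (β' : Fin m → ℝ),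
        (∀ i, bm ≤ β i ∧ β i ≤ bp) → (∀ j, bm ≤ β' j ∧ β' j ≤ bp) →
          w ^ 2 / (w ^ 2 + (ahD (ahDiag w (finExt (Fin.append β β'))) 1 0 (r + m)) ^ 2) ≤
            1 / (1 + (ahGamma w (ahTheta w) (finExt β) r) ^ 2 *
              (ahGamma w (ahPhase w (ahTheta w) (finExt β) r) (finExt β') m) ^ 2 *
              Real.sin (π * ahPhase w (ahPhase w (ahTheta w) (finExt β) r) (finExt β') m) ^ 2 /
                ((6 * π) ^ 2 * w ^ 4)) := by
  obtain ⟨w₇, hw₇, C₇, hC₇0, hC₇⟩ := ahFactor_bounds bm bp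
  have hsf := smallFreq_pos bm bp
  refine ⟨min (smallFreq bm bp) (min w₇ (1 / (2 * (C₇ + 1)))), by positivity, ?_⟩
  intro w hw
  have hw0 := hw.1
  have hws : w ≤ smallFreq bm bp := hw.2.trans (min_le_left _ _)
  have hw7 : w ∈ Set.Ioc 0 w₇ := ⟨hw0, hw.2.trans ((min_le_right _ _).trans (min_le_left _ _))⟩
  have hwC : w ≤ 1 / (2 * (C₇ + 1)) := hw.2.trans ((min_le_right _ _).trans (min_le_right _ _))
  have hfac : ∀ y b, b ∈ Set.Icc bm bp → Real.exp (-(C₇ * w)) ≤ ahFactor w y b :=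
    fun y b hb => (hC₇ w hw7 y b hb).1
  have hpos : ∀ (x : ℝ) (k : ℕ) (B : ℕ → ℝ), (∀ j, B j ∈ Set.Icc bm bp) → 0 < ahGamma w x B k :=
    fun x k B hB => Finset.prod_pos fun l _ => (Real.exp_pos _).trans_le (hfac _ _ (hB l))
  refine ⟨hpos, ?_⟩
  intro r m hr hm β β' hβ hβ'
  have hBk : ∀ k, finExt (Fin.append β β') k ∈ Set.Icc bm bp :=
    finExt_mem_Icc hbm hbp (append_mem_Icc hβ hβ')
  have hβk : ∀ k, finExt β k ∈ Set.Icc bm bp := finExt_mem_Icc hbm hbp hβ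
  have hβ'k : ∀ k, finExt β' k ∈ Set.Icc bm bp := finExt_mem_Icc hbm hbp hβ'
  have hexp : 1 / 2 ≤ Real.exp (-(C₇ * w)) := by
    have h1 : C₇ * w ≤ 1 / 2 := by
      calc C₇ * w ≤ (C₇ + 1) * w := by nlinarith
        _ ≤ (C₇ + 1) * (1 / (2 * (C₇ + 1))) := mul_le_mul_of_nonneg_left hwC (by positivity)
        _ = 1 / 2 := by field_simp
    linarith [Real.add_one_le_exp (-(C₇ * w))]
  set x := ahPhase w (ahTheta w) (finExt β) r with hx
  have hΓr : 0 < ahGamma w (ahTheta w) (finExt β) r := hpos _ _ _ hβk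
  have hΓm : 0 < ahGamma w x (finExt β') m := hpos _ _ _ hβ'k
  have hφ : 1 / 2 ≤ ahFactor w x (finExt β' 0) := hexp.trans (hfac _ _ (hβ'k 0))
  obtain ⟨-, hlow⟩ := ahD_e₁_lower hw0 hws hBk (by omega : 1 ≤ r + m)
  rw [ahGamma_append w (ahTheta w) β β' hr hm, ahPhase_append_right w (ahTheta w) β β' m] at hlow
  refine majorant_le_lorentz hw0 (by positivity) ?_
  set S := |Real.sin (π * ahPhase w x (finExt β') m)| with hS
  set D := |ahD (ahDiag w (finExt (Fin.append β β'))) 1 0 (r + m)| with hD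
  set Γr := ahGamma w (ahTheta w) (finExt β) r with hΓrdef
  set Γm := ahGamma w x (finExt β') m with hΓmdef
  set φ := ahFactor w x (finExt β' 0) with hφdef
  have hS0 : 0 ≤ S := abs_nonneg _
  have hmid : Γr * (1 / 2) * Γm ≤ Γr * φ * Γm :=
    mul_le_mul_of_nonneg_right (mul_le_mul_of_nonneg_left hφ hΓr.le) hΓm.le
  calc Γr * Γm * S = 2 * ((Γr * (1 / 2) * Γm) * S) := by ring
    _ ≤ 2 * ((Γr * φ * Γm) * S) :=
        mul_le_mul_of_nonneg_left (mul_le_mul_of_nonneg_right hmid hS0) zero_le_two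
    _ ≤ 2 * (3 * (π * w) * D) := mul_le_mul_of_nonneg_left hlow zero_le_two
    _ = 6 * (π * w) * D := by ring

/-! ### Bookkeeping for the display before (6.16) -/

/-- Case `m = n` (`w²n ≤ 1`, `Γ_0 = 1`): `K₀w/√n ≤ C max{w/√n, w²}e^{-αw²n}`, `C = 2K₀(|C₃|+1)e^{α}`
("`(w/√m)𝔼(1/Γ^ϑ_{n-m}) ≲ max{w/√n, w²}e^{-αw²n}`"). [cite: AjankiHuveneers2011, §6.2 (display before eq. (6.16))] -/
theorem final_bound_start {K₀ C₃ α w : ℝ} {n : ℕ} (hK : 0 ≤ K₀) (hα : 0 ≤ α)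
    (hwn : w ^ 2 * n ≤ 1) :
    K₀ * w / (Real.sqrt n * 1) ≤
      2 * K₀ * (|C₃| + 1) * Real.exp α * max (w / Real.sqrt n) (w ^ 2) *
        Real.exp (-(α * w ^ 2 * n)) := by
  have hmax0 : 0 ≤ max (w / Real.sqrt n) (w ^ 2) := le_max_of_le_right (sq_nonneg w)
  have h1 : K₀ * w / (Real.sqrt n * 1) ≤ K₀ * max (w / Real.sqrt n) (w ^ 2) := by
    rw [mul_one, mul_div_assoc]
    exact mul_le_mul_of_nonneg_left (le_max_left _ _) hK
  have h2 : 1 ≤ Real.exp α * Real.exp (-(α * w ^ 2 * n)) := by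
    rw [← Real.exp_add]
    apply Real.one_le_exp
    nlinarith [mul_le_mul_of_nonneg_left hwn hα]
  have h3 : K₀ * max (w / Real.sqrt n) (w ^ 2) ≤
      2 * K₀ * (|C₃| + 1) * max (w / Real.sqrt n) (w ^ 2) := by
    have : K₀ ≤ 2 * K₀ * (|C₃| + 1) := by nlinarith [abs_nonneg C₃]
    exact mul_le_mul_of_nonneg_right this hmax0
  calc K₀ * w / (Real.sqrt n * 1) ≤ K₀ * max (w / Real.sqrt n) (w ^ 2) * 1 := by
        rw [mul_one (K₀ * _)]
        exact h1
    _ ≤ (2 * K₀ * (|C₃| + 1) * max (w / Real.sqrt n) (w ^ 2)) *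
          (Real.exp α * Real.exp (-(α * w ^ 2 * n))) :=
        mul_le_mul h3 h2 zero_le_one (by positivity)
    _ = _ := by ring

/-- Case `m = ⌊w⁻²⌋ < n = r + m` (`w²m ≤ 1 ≤ 2w²m`): `(K₀w/√m)·C₃e^{-αw²r} ≤ C max{w/√n, w²}e^{-αw²n}`
("`(w/√m)e^{-αw²(n-m)} ≲ max{w/√n, w²}e^{-αw²n}`"). [cite: AjankiHuveneers2011, §6.2 (display before eq. (6.16))] -/
theorem final_bound_restart {K₀ C₃ α w : ℝ} {r m : ℕ} (hK : 0 ≤ K₀) (hα : 0 ≤ α) (hw : 0 < w)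
    (hm : (1 : ℝ) ≤ m) (hwm : w ^ 2 * m ≤ 1) (hmw : 1 ≤ 2 * w ^ 2 * m) :
    K₀ * w / Real.sqrt m * (C₃ * Real.exp (-(α * w ^ 2 * r))) ≤
      2 * K₀ * (|C₃| + 1) * Real.exp α * max (w / Real.sqrt ((r + m : ℕ) : ℝ)) (w ^ 2) *
        Real.exp (-(α * w ^ 2 * ((r + m : ℕ) : ℝ))) := by
  have hm0 : (0 : ℝ) < m := by linarith
  have hsm : 0 < Real.sqrt m := Real.sqrt_pos.mpr hm0
  have hws : w / Real.sqrt m ≤ 2 * w ^ 2 := by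
    rw [div_le_iff₀ hsm]
    have h4 : 1 ≤ 2 * w * Real.sqrt m := by
      have hsq : (1 : ℝ) ^ 2 ≤ (2 * w * Real.sqrt m) ^ 2 := by
        rw [one_pow, mul_pow, Real.sq_sqrt hm0.le]
        nlinarith
      exact le_of_pow_le_pow_left₀ two_ne_zero (by positivity) hsq
    nlinarith
  have hexp : Real.exp (-(α * w ^ 2 * r)) ≤
      Real.exp α * Real.exp (-(α * w ^ 2 * ((r + m : ℕ) : ℝ))) := by
    rw [← Real.exp_add, Real.exp_le_exp]
    push_cast
    nlinarith [mul_le_mul_of_nonneg_left hwm hα]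
  set M := max (w / Real.sqrt ((r + m : ℕ) : ℝ)) (w ^ 2) with hM
  have hmax : 2 * w ^ 2 ≤ 2 * M := by
    have := le_max_right (w / Real.sqrt ((r + m : ℕ) : ℝ)) (w ^ 2)
    linarith
  have hmax0 : 0 ≤ M := le_max_of_le_right (sq_nonneg w)
  set E := Real.exp (-(α * w ^ 2 * ((r + m : ℕ) : ℝ))) with hEdef
  calc K₀ * w / Real.sqrt m * (C₃ * Real.exp (-(α * w ^ 2 * r)))
      ≤ K₀ * w / Real.sqrt m * (|C₃| * Real.exp (-(α * w ^ 2 * r))) :=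
        mul_le_mul_of_nonneg_left
          (mul_le_mul_of_nonneg_right (le_abs_self _) (Real.exp_pos _).le) (by positivity)
    _ = K₀ * |C₃| * (w / Real.sqrt m) * Real.exp (-(α * w ^ 2 * r)) := by ring
    _ ≤ K₀ * |C₃| * (2 * M) * (Real.exp α * E) :=
        mul_le_mul (mul_le_mul_of_nonneg_left (hws.trans hmax) (by positivity)) hexp
          (Real.exp_pos _).le (by positivity)
    _ = 2 * K₀ * |C₃| * Real.exp α * M * E := by ring
    _ ≤ 2 * K₀ * (|C₃| + 1) * Real.exp α * M * E := by
        have h0 : 0 ≤ 2 * K₀ * Real.exp α * M * E := by positivity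
        nlinarith [h0]

end Literature.Barriers.AtomisticToContinuum.HeatConduction

namespace Literature.Barriers.AtomisticToContinuum

open HeatConduction

/-! ### The pointwise bound from Prop. 5.1 -/

/-- **AH2011 §6.2, `𝔼[(1 + w⁻²D_n(e₁;w)²)⁻¹] ≲ max{w/√n, w²}e^{-αw²n}` for `c/n ≤ w ≤ w₀`, PROVED
from Prop. 5.1** (`AjankiHuveneers2011_potentialTheory`, the only input of the printed proof that
is still a named fact; Cor. 3.6, (3.21) and Prop. 4.1 are theorems of the tree). The printed
chain: (6.11) `1/(1 + w⁻²D_n²) ≲ h(Γ^ϑ_n sin πX^ϑ_n)`; (6.13) condition on the first `n - m`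
steps, `m = min{n, ⌊w⁻²⌋}`; (6.14)–(6.15) Prop. 5.1 ⟹ `𝔼(…|x,a) ≲ (w/√m)a⁻¹`; then Prop. 4.1:
`𝔼 ≲ (w/√m)𝔼(1/Γ^ϑ_{n-m}) ≲ (w/√m)e^{-αw²(n-m)} ≲ max{w/√n, w²}e^{-αw²n}` (with `κ = min{c, 1}`
in Prop. 5.1: `wm ≥ c` if `m = n`, `wm ≥ 1/w - w ≥ 1` if `m = ⌊w⁻²⌋`, `w ≤ 1/2`).
[cite: AjankiHuveneers2011, §6.2 eqs. (6.11), (6.13)-(6.15) and the display before (6.16) (arXiv v1 numbering)] -/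
theorem AjankiHuveneers2011_pointwiseCurrentBound_of_potentialTheory
    (h5 : AjankiHuveneers2011_potentialTheory) : AjankiHuveneers2011_pointwiseCurrentBound := by
  intro τ bm bp hτ ρB _ hρ c hc
  have hbm := hτ.bm_nonpos
  have hbp := hτ.bp_nonneg
  -- constants
  set κ : ℝ := min c 1 with hκ
  have hκ0 : 0 < κ := by positivity
  have hκc : κ ≤ c := min_le_left _ _
  have hκ1 : κ ≤ 1 := min_le_right _ _
  have hL : (0 : ℝ) < 6 * π := by positivity
  obtain ⟨wD, hwD, K₀, hK₀, hcore⟩ := pointwise_core h5 hτ ρB hρ hκ0 hL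
  obtain ⟨w₃, hw₃, α, hα, C₃, h41⟩ := AjankiHuveneers2011_invGammaDecay_holds τ bm bp hτ ρB hρ
  obtain ⟨wE, hwE, hE⟩ := majorant_append_le bm bp hbm hbp
  have hsf := smallFreq_pos bm bp
  set w₀ : ℝ := min (min (min wD w₃) (min wE (smallFreq bm bp))) (1 / 2) with hw₀
  have hw₀pos : 0 < w₀ := by positivity
  set C : ℝ := 2 * K₀ * (|C₃| + 1) * Real.exp α with hC
  refine ⟨w₀, hw₀pos, α, hα, C, ?_⟩
  intro n hn w hw
  obtain ⟨hwlo, hwhi⟩ := hw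
  have hn0 : (0 : ℝ) < n := by exact_mod_cast hn
  have hw0 : 0 < w := lt_of_lt_of_le (by positivity) hwlo
  have hwa : w ≤ min (min wD w₃) (min wE (smallFreq bm bp)) := hwhi.trans (min_le_left _ _)
  have hwD' : w ∈ Set.Ioc 0 wD := ⟨hw0, hwa.trans ((min_le_left _ _).trans (min_le_left _ _))⟩
  have hw3' : w ∈ Set.Ioc 0 w₃ := ⟨hw0, hwa.trans ((min_le_left _ _).trans (min_le_right _ _))⟩
  have hwE' : w ∈ Set.Ioc 0 wE := ⟨hw0, hwa.trans ((min_le_right _ _).trans (min_le_left _ _))⟩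
  have hws : w ≤ smallFreq bm bp := hwa.trans ((min_le_right _ _).trans (min_le_right _ _))
  have hwhalf : w ≤ 1 / 2 := hwhi.trans (min_le_right _ _)
  have hw1 : w ≤ 1 := by linarith
  have hwn : c ≤ w * n := by rwa [div_le_iff₀ hn0] at hwlo
  -- the integrand `F(B) = w²/(w² + D_k(e₁)²) ∈ [0, 1]`
  have hF01 : ∀ (k : ℕ) (B : Fin k → ℝ),
      0 ≤ w ^ 2 / (w ^ 2 + (ahD (ahDiag w (finExt B)) 1 0 k) ^ 2) ∧
        w ^ 2 / (w ^ 2 + (ahD (ahDiag w (finExt B)) 1 0 k) ^ 2) ≤ 1 :=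
    fun k B => reducedMajorant_mem _ _
  have hFint : ∀ k : ℕ, Integrable
      (fun B : Fin k → ℝ => w ^ 2 / (w ^ 2 + (ahD (ahDiag w (finExt B)) 1 0 k) ^ 2))
      (Measure.pi fun _ : Fin k => ρB) := fun k =>
    Integrable.mono' (integrable_const (1 : ℝ)) (measurable_reducedMajorant w k k).aestronglyMeasurable
      (ae_of_all _ fun B => by
        rw [Real.norm_eq_abs, abs_of_nonneg (hF01 k B).1]
        exact (hF01 k B).2)
  rcases le_or_gt n ⌊w⁻¹ ^ 2⌋₊ with hcase | hcase
  · -- `m = n`: no conditioning, `x = ϑ`, `a = Γ_0 = 1`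
    have hwn2 : w ^ 2 * n ≤ 1 := by
      have h1 : (n : ℝ) ≤ ⌊w⁻¹ ^ 2⌋₊ := by exact_mod_cast hcase
      have h2 : (⌊w⁻¹ ^ 2⌋₊ : ℝ) ≤ w⁻¹ ^ 2 := Nat.floor_le (by positivity)
      calc w ^ 2 * n ≤ w ^ 2 * (w⁻¹ ^ 2) := mul_le_mul_of_nonneg_left (h1.trans h2) (sq_nonneg w)
        _ = 1 := by field_simp
    have hκn : κ ≤ w * n := hκc.trans hwn
    obtain ⟨G, hGi, hGle, hGint⟩ := hcore w hwD' n hκn hwn2 (ahTheta w) 1 one_pos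
    calc ∫ B, w ^ 2 / (w ^ 2 + (ahD (ahDiag w (finExt B)) 1 0 n) ^ 2) ∂(Measure.pi fun _ : Fin n => ρB)
        ≤ ∫ B, G B ∂(Measure.pi fun _ : Fin n => ρB) := by
          refine integral_mono_of_nonneg (ae_of_all _ fun B => (hF01 n B).1) hGi ?_
          filter_upwards [hGle, ae_pi_mem_Icc hτ.eq_zero hρ n] with B hB hBrange
          exact (majorant_le_start hw0 hws hbm hbp hn B hBrange).trans hB
      _ ≤ K₀ * w / (Real.sqrt n * 1) := hGint
      _ ≤ C * max (w / Real.sqrt n) (w ^ 2) * Real.exp (-(α * w ^ 2 * n)) :=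
          final_bound_start hK₀.le hα.le hwn2
  · -- `m = ⌊w⁻²⌋ < n`: condition on the first `r = n - m` steps
    set m := ⌊w⁻¹ ^ 2⌋₊ with hm
    have hwinv : 1 ≤ w⁻¹ := (one_le_inv₀ hw0).mpr hw1
    have hm1 : 1 ≤ m := by
      rw [hm, Nat.one_le_floor_iff]
      exact one_le_pow₀ hwinv
    have hm1' : (1 : ℝ) ≤ m := by exact_mod_cast hm1
    obtain ⟨r, rfl⟩ : ∃ r, n = r + m := ⟨n - m, by omega⟩
    have hr1 : 1 ≤ r := by omega
    have hfloor : (m : ℝ) ≤ w⁻¹ ^ 2 := Nat.floor_le (by positivity)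
    have hwm2 : w ^ 2 * m ≤ 1 := by
      calc w ^ 2 * m ≤ w ^ 2 * (w⁻¹ ^ 2) := mul_le_mul_of_nonneg_left hfloor (sq_nonneg w)
        _ = 1 := by field_simp
    have hmlow : w⁻¹ ^ 2 ≤ m + 1 := (Nat.lt_floor_add_one _).le
    have hmw : 1 ≤ 2 * w ^ 2 * m := by
      -- `m ≥ w⁻² - 1 ≥ w⁻²/2` since `w⁻² ≥ 4`
      have h4 : (4 : ℝ) ≤ w⁻¹ ^ 2 := by nlinarith [hwinv, (le_inv_comm₀ two_pos hw0).mpr (by linarith : w ≤ 2⁻¹)]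
      have h5' : w ^ 2 * (w⁻¹ ^ 2) = 1 := by field_simp
      nlinarith [mul_le_mul_of_nonneg_left hmlow (sq_nonneg w), sq_nonneg w,
        mul_le_mul_of_nonneg_left h4 (sq_nonneg w)]
    have hκm : κ ≤ w * m := by
      have h1 : w * (w⁻¹ ^ 2 - 1) ≤ w * m := mul_le_mul_of_nonneg_left (by linarith) hw0.le
      have h2 : w * (w⁻¹ ^ 2 - 1) = w⁻¹ - w := by field_simp
      have h3 : (2 : ℝ) ≤ w⁻¹ := (le_inv_comm₀ two_pos hw0).mpr (by linarith : w ≤ 2⁻¹)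
      linarith
    obtain ⟨hI41, hB41⟩ := h41 w hw3' r (ahTheta w)
    obtain ⟨hΓpos, hEb⟩ := hE w hwE'
    -- the inner (conditional) bound, a.e. in the first block `β`
    have hinner : ∀ᵐ β ∂(Measure.pi fun _ : Fin r => ρB),
        (∫ β', w ^ 2 / (w ^ 2 + (ahD (ahDiag w (finExt (Fin.append β β'))) 1 0 (r + m)) ^ 2)
            ∂(Measure.pi fun _ : Fin m => ρB)) ≤
          K₀ * w / Real.sqrt m * (ahGamma w (ahTheta w) (finExt β) r)⁻¹ := by
      filter_upwards [ae_pi_mem_Icc hτ.eq_zero hρ r] with β hβ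
      have ha : 0 < ahGamma w (ahTheta w) (finExt β) r :=
        hΓpos _ _ _ (finExt_mem_Icc hbm hbp hβ)
      obtain ⟨G, hGi, hGle, hGint⟩ :=
        hcore w hwD' m hκm hwm2 (ahPhase w (ahTheta w) (finExt β) r) _ ha
      calc (∫ β', w ^ 2 / (w ^ 2 + (ahD (ahDiag w (finExt (Fin.append β β'))) 1 0 (r + m)) ^ 2)
            ∂(Measure.pi fun _ : Fin m => ρB))
          ≤ ∫ β', G β' ∂(Measure.pi fun _ : Fin m => ρB) := by
            refine integral_mono_of_nonneg (ae_of_all _ fun β' => (hF01 _ _).1) hGi ?_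
            filter_upwards [hGle, ae_pi_mem_Icc hτ.eq_zero hρ m] with β' hG hβ'
            exact (hEb r m hr1 hm1 β β' hβ hβ').trans hG
        _ ≤ K₀ * w / (Real.sqrt m * ahGamma w (ahTheta w) (finExt β) r) := hGint
        _ = K₀ * w / Real.sqrt m * (ahGamma w (ahTheta w) (finExt β) r)⁻¹ := by
            rw [div_mul_eq_div_div, div_eq_mul_inv]
    calc ∫ B, w ^ 2 / (w ^ 2 + (ahD (ahDiag w (finExt B)) 1 0 (r + m)) ^ 2)
          ∂(Measure.pi fun _ : Fin (r + m) => ρB)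
        = ∫ β, (∫ β', w ^ 2 / (w ^ 2 + (ahD (ahDiag w (finExt (Fin.append β β'))) 1 0 (r + m)) ^ 2)
            ∂(Measure.pi fun _ : Fin m => ρB)) ∂(Measure.pi fun _ : Fin r => ρB) :=
          integral_pi_append ρB r m _ (hFint (r + m))
      _ ≤ ∫ β, K₀ * w / Real.sqrt m * (ahGamma w (ahTheta w) (finExt β) r)⁻¹
            ∂(Measure.pi fun _ : Fin r => ρB) :=
          integral_mono_of_nonneg (ae_of_all _ fun β => integral_nonneg fun β' => (hF01 _ _).1)
            (hI41.const_mul _) hinner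
      _ = K₀ * w / Real.sqrt m * ∫ β, (ahGamma w (ahTheta w) (finExt β) r)⁻¹
            ∂(Measure.pi fun _ : Fin r => ρB) := integral_const_mul _ _
      _ ≤ K₀ * w / Real.sqrt m * (C₃ * Real.exp (-(α * w ^ 2 * r))) :=
          mul_le_mul_of_nonneg_left hB41 (by positivity)
      _ ≤ C * max (w / Real.sqrt ((r + m : ℕ) : ℝ)) (w ^ 2) * Real.exp (-(α * w ^ 2 * ((r + m : ℕ) : ℝ))) :=
          final_bound_restart hK₀.le hα.le hw0 hm1' hwm2 hmw

end Literature.Barriers.AtomisticToContinuum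

end
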